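import Summits.AtomisticToContinuum.HydrodynamicLimit.Theorems.CollisionIsometryCLTMacroClosureEngineGronwall
import Mathlib.Analysis.SpecialFunctions.Pow.Real
import HarnessLib

/-!
# Sub-goal `engine_core` of the lead's `stub_engine` (line `IdeatorTwoGen1Sketch`, crux `MacroClosure`,
stmt-AtomisticToContinuum-14870): the abstract barycentric Gronwall

Pure real analysis, no measure theory: the expected block relative entropies `H_N(s) ≥ 0` and the linear
statistics `ℓ_N(s)` of the line satisfy (a) the ENTROPY LEDGER `H_N(s) + ℓ_N(s) ≤ δ` eventually in `N`,
uniformly in `s ≤ t`, for every `δ > 0` (Clausius in mean + classical isentropy + commutators); (b) the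
INCREMENT BOUND `ℓ_N(0) − ℓ_N(s) ≤ K√M ∫₀ˢ H_N + K√M e^{−λM/4} + err_N` for every truncation level `M ≥ 1`
(tested balance laws + relative-flux race + hot cells paid by the a-priori exponential moment), `err_N → 0`;
(c) `ℓ_N(0) → 0` (law of large numbers at `t = 0`). CONCLUSION: `H_N(s) → 0` for every `s ≤ t` — Gronwall
(`engine_gronwall`) at fixed `M` gives `limsup_N H_N ≤ K√M e^{−λM/4} e^{K√M t}`, and `M → ∞`.
-/

noncomputable section

open MeasureTheory Filter Set Topology

namespace Summit.AtomisticToContinuum.HydrodynamicLimit.Theorems.MacroClosureLine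

namespace Barycentric

namespace Core

/-- The race is won by the Gaussian tail: `K √M e^{−λM/4} e^{K√M t} → 0` as `M → ∞`. -/
theorem tendsto_race (K lam t : ℝ) (hK : 0 ≤ K) (hlam : 0 < lam) :
    Tendsto (fun M : ℝ => K * Real.sqrt M * Real.exp (-(lam * M / 4)) * Real.exp (K * Real.sqrt M * t))
      atTop (𝓝 0) := by
  -- domination: for `M ≥ 0`, `√M ≤ (lam/16) M + 4/lam` and `K t √M ≤ (lam/16) M + 4 K² t²/lam`
  have hdom : ∀ M : ℝ, 0 ≤ M →
      K * Real.sqrt M * Real.exp (-(lam * M / 4)) * Real.exp (K * Real.sqrt M * t) ≤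
        K * Real.exp (4 / lam + 4 * K ^ 2 * t ^ 2 / lam) * Real.exp (-(lam * M / 8)) := by
    intro M hM
    have hs : 0 ≤ Real.sqrt M := Real.sqrt_nonneg M
    have hsq : Real.sqrt M ^ 2 = M := Real.sq_sqrt hM
    have h1 : Real.sqrt M ≤ lam / 16 * M + 4 / lam := by
      have : 0 ≤ (Real.sqrt M * lam / 4 - 2) ^ 2 := sq_nonneg _
      have hl : lam ≠ 0 := hlam.ne'
      have key : lam / 16 * M + 4 / lam - Real.sqrt M = (Real.sqrt M * lam / 4 - 2) ^ 2 / lam := by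
        field_simp
        nlinarith [hsq]
      have : 0 ≤ (Real.sqrt M * lam / 4 - 2) ^ 2 / lam := div_nonneg (sq_nonneg _) hlam.le
      linarith
    have h2 : K * Real.sqrt M * t ≤ lam / 16 * M + 4 * K ^ 2 * t ^ 2 / lam := by
      have hl : lam ≠ 0 := hlam.ne'
      have key : lam / 16 * M + 4 * K ^ 2 * t ^ 2 / lam - K * Real.sqrt M * t =
          (Real.sqrt M * lam / 4 - 2 * K * t) ^ 2 / lam := by
        field_simp
        nlinarith [hsq]
      have : 0 ≤ (Real.sqrt M * lam / 4 - 2 * K * t) ^ 2 / lam := div_nonneg (sq_nonneg _) hlam.le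
      linarith
    -- `√M ≤ exp √M`
    have h3 : Real.sqrt M ≤ Real.exp (Real.sqrt M) := by
      have := Real.add_one_le_exp (Real.sqrt M); linarith
    calc K * Real.sqrt M * Real.exp (-(lam * M / 4)) * Real.exp (K * Real.sqrt M * t)
        ≤ K * Real.exp (Real.sqrt M) * Real.exp (-(lam * M / 4)) * Real.exp (K * Real.sqrt M * t) := by
          gcongr
      _ = K * Real.exp (Real.sqrt M + -(lam * M / 4) + K * Real.sqrt M * t) := by
          rw [Real.exp_add, Real.exp_add]; ring
      _ ≤ K * Real.exp ((4 / lam + 4 * K ^ 2 * t ^ 2 / lam) + -(lam * M / 8)) := by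
          apply mul_le_mul_of_nonneg_left _ hK
          apply Real.exp_le_exp.2
          linarith
      _ = K * Real.exp (4 / lam + 4 * K ^ 2 * t ^ 2 / lam) * Real.exp (-(lam * M / 8)) := by
          rw [Real.exp_add]; ring
  have hlim : Tendsto (fun M : ℝ => K * Real.exp (4 / lam + 4 * K ^ 2 * t ^ 2 / lam) *
      Real.exp (-(lam * M / 8))) atTop (𝓝 0) := by
    have h1 : Tendsto (fun M : ℝ => -(lam * M / 8)) atTop atBot := by
      have : (fun M : ℝ => -(lam * M / 8)) = fun M => (-(lam / 8)) * M := by funext M; ring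
      rw [this]
      exact tendsto_id.const_mul_atTop_of_neg (by linarith : -(lam / 8) < 0)
    have h2 := Real.tendsto_exp_atBot.comp h1
    simpa using h2.const_mul (K * Real.exp (4 / lam + 4 * K ^ 2 * t ^ 2 / lam))
  refine tendsto_of_tendsto_of_tendsto_of_le_of_le' tendsto_const_nhds hlim ?_ ?_
  · filter_upwards [eventually_ge_atTop (0 : ℝ)] with M hM
    positivity
  · filter_upwards [eventually_ge_atTop (0 : ℝ)] with M hM
    exact hdom M hM

end Core

open Core in
/-- **`engine_core` (registered sub-goal of `stub_engine`): the abstract barycentric Gronwall.** If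
`H_N ≥ 0` is integrable on `[0,t]`, `H_N(s) + ℓ_N(s) ≤ δ` eventually for every `δ > 0` (uniformly in
`s ≤ t`), `ℓ_N(0) − ℓ_N(s) ≤ K√M ∫₀ˢ H_N + K√M e^{−λM/4} + err_N` eventually for every `M ≥ 1`, `err_N → 0` and
`ℓ_N(0) → 0`, then `H_N(s) → 0` for every `s ∈ [0,t]`. [folklore] -/
theorem engine_core : ∀ (t K lam : ℝ), 0 < t → 0 ≤ K → 0 < lam →
    ∀ (H ℓ : ℕ → ℝ → ℝ) (err : ℕ → ℝ),
    (∀ N, ∀ s ∈ Icc 0 t, 0 ≤ H N s) → (∀ N, IntegrableOn (H N) (Icc 0 t)) →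
    (∀ δ : ℝ, 0 < δ → ∀ᶠ N in atTop, ∀ s ∈ Icc 0 t, H N s + ℓ N s ≤ δ) →
    (∀ M : ℝ, 1 ≤ M → ∀ᶠ N in atTop, ∀ s ∈ Icc 0 t,
      ℓ N 0 - ℓ N s ≤ K * Real.sqrt M * (∫ τ in Icc 0 s, H N τ) +
        K * Real.sqrt M * Real.exp (-(lam * M / 4)) + err N) →
    Tendsto err atTop (𝓝 0) → Tendsto (fun N => ℓ N 0) atTop (𝓝 0) →
    ∀ s ∈ Icc 0 t, Tendsto (fun N => H N s) atTop (𝓝 0) := by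
  intro t K lam ht hK hlam H ℓ err hH0 hHint hledger hincr herr hℓ0 s₀ hs₀
  rw [tendsto_order]
  refine ⟨fun a ha => Eventually.of_forall fun N => ha.trans_le (hH0 N s₀ hs₀), fun ε hε => ?_⟩
  -- choose the truncation level `M`
  have hrace := tendsto_race K lam t hK hlam
  obtain ⟨M, hM1, hMrace⟩ : ∃ M : ℝ, 1 ≤ M ∧
      K * Real.sqrt M * Real.exp (-(lam * M / 4)) * Real.exp (K * Real.sqrt M * t) < ε / 4 := by
    have h := ((tendsto_order.1 hrace).2 (ε / 4) (by positivity)).and (eventually_ge_atTop (1 : ℝ))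
    obtain ⟨M, hMlt, hM1⟩ := h.exists
    exact ⟨M, hM1, hMlt⟩
  set B : ℝ := K * Real.sqrt M with hB
  have hB0 : 0 ≤ B := mul_nonneg hK (Real.sqrt_nonneg M)
  set δ : ℝ := ε * Real.exp (-(B * t)) / 4 with hδ
  have hδ0 : 0 < δ := by positivity
  -- gather the eventual hypotheses
  have h1 := hledger δ hδ0
  have h2 := hincr M hM1
  have h3 : ∀ᶠ N in atTop, |err N| < δ := by
    have h := (tendsto_order.1 ((continuous_abs.tendsto 0).comp herr)).2 δ (by simpa using hδ0)
    simpa using h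
  have h4 : ∀ᶠ N in atTop, |ℓ N 0| < δ := by
    have h := (tendsto_order.1 ((continuous_abs.tendsto 0).comp hℓ0)).2 δ (by simpa using hδ0)
    simpa using h
  filter_upwards [h1, h2, h3, h4] with N hN1 hN2 hN3 hN4
  -- the integral inequality `H ≤ A + B ∫ H` on `[0,t]`
  set A : ℝ := 3 * δ + K * Real.sqrt M * Real.exp (-(lam * M / 4)) with hA
  have hineq : ∀ s ∈ Icc 0 t, H N s ≤ A + B * ∫ τ in Icc 0 s, H N τ := by
    intro s hs
    have e1 := hN1 s hs
    have e2 := hN2 s hs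
    have e3 := (abs_lt.1 hN3).2
    have e4 := (abs_lt.1 hN4).1
    have e4' := (abs_lt.1 hN4).2
    simp only [hA, hB]
    nlinarith [e1, e2, e3, e4, e4']
  have hG := engine_gronwall (H N) A B t hB0 ht.le (hH0 N) (hHint N) hineq s₀ hs₀
  -- `A e^{B s₀} ≤ A e^{B t} = 3δ e^{Bt} + (race) < 3ε/4 + ε/4`
  have hA0 : 0 ≤ A := by positivity
  have hexp : Real.exp (B * s₀) ≤ Real.exp (B * t) := Real.exp_le_exp.2 (by nlinarith [hs₀.2])
  have hδexp : δ * Real.exp (B * t) = ε / 4 := by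
    simp only [hδ]
    rw [div_mul_eq_mul_div, mul_assoc, ← Real.exp_add, neg_add_cancel, Real.exp_zero, mul_one]
  calc H N s₀ ≤ A * Real.exp (B * s₀) := hG
    _ ≤ A * Real.exp (B * t) := mul_le_mul_of_nonneg_left hexp hA0
    _ = 3 * (δ * Real.exp (B * t)) +
          K * Real.sqrt M * Real.exp (-(lam * M / 4)) * Real.exp (K * Real.sqrt M * t) := by
        simp only [hA, hB]; ring
    _ < 3 * (ε / 4) + ε / 4 := by rw [hδexp]; linarith
    _ = ε := by ring

end Barycentric

end Summit.AtomisticToContinuum.HydrodynamicLimit.Theorems.MacroClosureLine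

end
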